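import Summits.CriticalPhenomena.PercolationContinuityZ3.Theorems.PercNearOneGluingNoHeavyLowerTailSunflowerBottomSlackIntersecting
import HarnessLib
import HarnessLib.Audit

/-!
# `NoHeavyLowerTail` (crux stmt-CriticalPhenomena-4575), abstract sunflower cubic: the RAINBOW MATROID PARTITION — a one-sided rank bound
# on each spectator class and the typed conjecture `RainbowMatroidPartition` (⟹ ★), the decoupled form of `RainbowKernelIndependence`

Support file (seat `prim-l12-p2` gen 21; `--supports stmt-CriticalPhenomena-4575`).  No `sorry`.  One new definition: the `@[conjecture]`
`RainbowMatroidPartition` (an obligation of this programme — census-true, unproved —, never a fact).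
Memo: run/shared/lean/prim/prim-l12/prim-l12-p2/FINDING-g21-MATROID-PARTITION.md.

SETTING (gens 18–20: `…SunflowerRainbowVectors`, `…Reduction`, `…BottomSlack`, `…BottomSlackIntersecting`).  ★ (`PartitionLemmaH`) reads
`#rainbows ≤ Σ_{lab S = 0} cubeSlack Sᶜ + Σ_{lab S = 4} cubeSlack Sᶜ` (`ZH_eq_six_slack`).  The two-stage rainbow vector `rbVec ρ = TS-B_ρ + TS-A_ρ`
lives on the bottom-spectator supplies (`TS-B`, `lab σ.2 = 0`) and on the kernel-spectator supplies (`TS-A`, `lab σ.2 = 4`) and is orthogonal to every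
spectator row (`rbVec_orth`).

* `Sunflower.card_sup_spec_eq`, `Sunflower.card_dem_spec_eq` — for `v ∈ {0,4}`: `#{σ ∈ sup : lab σ.2 = v} = Σ_{lab S = v} #AB(Sᶜ)` and
  `#{d ∈ dem, non-rainbow, lab d.1 = v} = Σ_{lab S = v} #CR(Sᶜ)` (gen 20 proved the case `v = 0`).
* **`Sunflower.card_le_slack_of_linearIndependent`** — ONE-SIDED RANK BOUND: if `R` is a set of rainbows whose vectors RESTRICTED to the
  `v`-spectator supplies are linearly independent over `GF(2)`, then `#R ≤ Σ_{lab S = v} cubeSlack Sᶜ` (rank–nullity in `GF(2)^{sup_v}`: the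
  `v`-spectator rows are independent by the cube theorem `specRows_indep` and the restricted rainbow vectors lie in their kernel).  With `v = 0` and
  `R` = all rainbows this is gen 20's `bottomSlack_of_intersecting_petal_one` once independence is supplied.
* `RainbowMatroidPartition` (MP, typed conjecture, NEW): the rainbows split as `R_B ⊔ R_A` with `{TS-B_ρ}_{ρ ∈ R_B}` independent and
  `{TS-A_ρ}_{ρ ∈ R_A}` independent.  By Edmonds' matroid-partition theorem MP ⟺ `#X ≤ rank_B(X) + rank_A(X)` for every set `X` of rainbows, so
  `RainbowKernelIndependence` (gen 18) ⟹ MP; MP is the WEAKEST statement of the GF(2) programme that still gives ★ by counting.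
  CENSUS (gen 21, exact GF(2) matroid-partition algorithm): n ≤ 4 exhaustive (780 sunflowers with rainbows), 199 128 compositions
  `θ∘(OR/AND gadgets)` (θ on 4 points, n ≤ 6) and their perturbations, 1 500 'hard' all-petals-non-intersecting and 2 000 random sunflowers on 6
  points, the cyclic star `CS(3,3,3)` on 9 points (`…SunflowerPurePayerRefutation`: BOTH `KA = 216 < 217 = #rainbows` and `KB = 163 < 217`, so
  neither side alone can pay — the 'rank dichotomy' is FALSE there) and its 39 single-relabelling neighbours: a partition exists in EVERY instance,
  already in the fixed petal order.
* **`partitionLemmaH_of_rainbowMatroidPartition`** : MP ⟹ ★.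
-/

namespace Summit.CriticalPhenomena.PercolationContinuityZ3.Theorems.SunflowerPartition

open Finset

namespace Sunflower

variable {α : Type*} [Fintype α] [DecidableEq α] (F : Sunflower α)

/-! ## Counting the `v`-spectator supplies and demands (`v ∈ {0, 4}`) -/

/-- `#sup_v = Σ_{lab S = v} #AB(Sᶜ)` for a spectator value `v ∈ {0,4}`. [this work] -/
theorem card_sup_spec_eq (v : Fin 5) (hv : v = 4 ∨ v = 0) :
    (F.sup.filter (fun σ => F.lab σ.2 = v)).card
      = ∑ S ∈ (Finset.univ : Finset (Finset α)).filter (fun S => F.lab S = v), F.abCard Sᶜ := by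
  rw [Finset.card_eq_sum_card_fiberwise (f := fun σ : Finset α × Finset α => σ.2) (t := (Finset.univ : Finset (Finset α)))
    (fun _ _ => mem_coe.2 (mem_univ _))]
  rw [Finset.sum_filter]
  refine sum_congr rfl fun S _ => ?_
  by_cases hS : F.lab S = v
  · rw [if_pos hS]
    have : (F.sup.filter (fun σ => F.lab σ.2 = v)).filter (fun σ => σ.2 = S) = F.sup.filter (fun σ => σ.2 = S) := by
      ext σ; simp only [mem_filter]
      constructor
      · rintro ⟨⟨h1, -⟩, h3⟩; exact ⟨h1, h3⟩
      · rintro ⟨h1, h3⟩; exact ⟨⟨h1, by rw [h3]; exact hS⟩, h3⟩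
    have hS' : F.lab S = 4 ∨ F.lab S = 0 := by rcases hv with h | h <;> rw [← h] <;> simp [hS]
    rw [this, F.card_sup_fiber S, if_pos hS']
  · rw [if_neg hS, Finset.card_eq_zero, Finset.filter_eq_empty_iff]
    intro σ hσ h3
    exact hS (h3 ▸ (mem_filter.1 hσ).2)

/-- `#(non-rainbow demands with a `v`-spectator) = Σ_{lab S = v} #CR(Sᶜ)` for `v ∈ {0,4}`. [this work] -/
theorem card_dem_spec_eq (v : Fin 5) (hv : v = 4 ∨ v = 0) :
    ((F.dem.filter (fun d => ¬ F.IsRainbow d)).filter (fun d => F.lab d.1 = v)).card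
      = ∑ S ∈ (Finset.univ : Finset (Finset α)).filter (fun S => F.lab S = v), F.crCard Sᶜ := by
  rw [Finset.card_eq_sum_card_fiberwise (f := fun d : Finset α × Finset α => d.1) (t := (Finset.univ : Finset (Finset α)))
    (fun _ _ => mem_coe.2 (mem_univ _))]
  rw [Finset.sum_filter]
  refine sum_congr rfl fun S _ => ?_
  by_cases hS : F.lab S = v
  · rw [if_pos hS]
    have : ((F.dem.filter (fun d => ¬ F.IsRainbow d)).filter (fun d => F.lab d.1 = v)).filter (fun d => d.1 = S)
        = (F.dem.filter (fun d => ¬ F.IsRainbow d)).filter (fun d => d.1 = S) := by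
      ext d; simp only [mem_filter]
      constructor
      · rintro ⟨⟨h1, -⟩, h3⟩; exact ⟨h1, h3⟩
      · rintro ⟨h1, h3⟩; exact ⟨⟨h1, by rw [h3]; exact hS⟩, h3⟩
    have hS' : F.lab S = 4 ∨ F.lab S = 0 := by rcases hv with h | h <;> rw [← h] <;> simp [hS]
    rw [this, F.card_dem_spec_fiber S, if_pos hS']
  · rw [if_neg hS, Finset.card_eq_zero, Finset.filter_eq_empty_iff]
    intro d hd h3
    exact hS (h3 ▸ (mem_filter.1 hd).2)

/-! ## The one-sided rank bound -/

/-- **ONE-SIDED RANK BOUND** (this work).  Let `v ∈ {0,4}` and let `R` be a set of rainbows whose two-stage vectors, restricted to the supplies with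
a `v`-labelled spectator, are linearly independent over `GF(2)`.  Then `#R ≤ Σ_{lab S = v} cubeSlack Sᶜ`.  Rank–nullity in `GF(2)^{sup_v}`: the
`v`-spectator rows are independent (`specRows_indep`, coefficients extended by zero) and number `Σ_{lab S = v} #CR(Sᶜ)`; the restricted rainbow vectors
lie in their kernel (`rbVec_orth`); `#sup_v = Σ_{lab S = v} #AB(Sᶜ)`. [this work] -/
theorem card_le_slack_of_linearIndependent (v : Fin 5) (hv : v = 4 ∨ v = 0) (R : Finset (Finset α × Finset α))
    (hR : R ⊆ F.dem.filter (fun d => F.IsRainbow d))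
    (hli : LinearIndependent (ZMod 2)
      (fun ρ : ↥R => fun σ : ↥(F.sup.filter (fun σ => F.lab σ.2 = v)) => F.rbVec ρ.1 σ.1)) :
    (R.card : ℤ) ≤ ∑ S ∈ (Finset.univ : Finset (Finset α)).filter (fun S => F.lab S = v), F.cubeSlack Sᶜ := by
  classical
  set supV := F.sup.filter (fun σ => F.lab σ.2 = v) with hsupV
  set SPV := (F.dem.filter (fun d => ¬ F.IsRainbow d)).filter (fun d => F.lab d.1 = v) with hSPV
  let Rm : Matrix ↥SPV ↥supV (ZMod 2) := Matrix.of fun d σ => F.specRow d.1 σ.1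
  -- (1) the rows of `Rm` are independent
  have hinj : Function.Injective (Matrix.mulVecLin Rm.transpose) := by
    rw [← LinearMap.ker_eq_bot, LinearMap.ker_eq_bot']
    intro g hg
    let c : Finset α × Finset α → ZMod 2 := fun d => if hd : d ∈ SPV then g ⟨d, hd⟩ else 0
    have hc : ∀ σ ∈ F.sup, (∑ d ∈ F.dem.filter (fun d => ¬ F.IsRainbow d), c d * F.specRow d σ) = 0 := by
      intro σ hσ
      have hsplit : (∑ d ∈ F.dem.filter (fun d => ¬ F.IsRainbow d), c d * F.specRow d σ) = ∑ d ∈ SPV, c d * F.specRow d σ := by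
        symm
        refine Finset.sum_subset (by rw [hSPV]; exact Finset.filter_subset _ _) fun d _ hdn => ?_
        simp only [c, dif_neg hdn, zero_mul]
      rw [hsplit]
      by_cases hσV : σ ∈ supV
      · have h0 : (Rm.transpose.mulVec g) ⟨σ, hσV⟩ = 0 :=
          congrFun (show Rm.transpose.mulVec g = 0 from (Matrix.mulVecLin_apply Rm.transpose g).symm.trans hg) ⟨σ, hσV⟩
        simp only [Matrix.mulVec, dotProduct, Matrix.transpose_apply, Rm, Matrix.of_apply] at h0
        rw [← Finset.sum_coe_sort SPV]
        refine Eq.trans (sum_congr rfl fun x _ => ?_) h0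
        simp only [c, dif_pos x.2]
        ring
      · refine sum_eq_zero fun d hd => ?_
        have hdv : F.lab d.1 = v := (mem_filter.1 hd).2
        have hne : σ.2 ≠ d.1 := fun h => hσV (mem_filter.2 ⟨hσ, by rw [h]; exact hdv⟩)
        unfold specRow
        rw [if_neg hne, mul_zero]
    have hz := F.specRows_indep c hc
    funext x
    have := hz x.1 (mem_filter.1 x.2).1
    simp only [c, dif_pos x.2] at this
    rw [this, Pi.zero_apply]
  -- (2) rank of the row map
  have hrank : Module.finrank (ZMod 2) (LinearMap.range (Matrix.mulVecLin Rm)) = Fintype.card ↥SPV := by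
    have h1 : Rm.rank = Rm.transpose.rank := (Matrix.rank_transpose Rm).symm
    unfold Matrix.rank at h1
    rw [h1, LinearMap.finrank_range_of_inj hinj, Module.finrank_fintype_fun_eq_card]
  -- (3) the restricted rainbow vectors lie in the kernel
  have hker : Submodule.span (ZMod 2) (Set.range (fun ρ : ↥R => fun σ : ↥supV => F.rbVec ρ.1 σ.1))
      ≤ LinearMap.ker (Matrix.mulVecLin Rm) := by
    rw [Submodule.span_le]
    rintro w ⟨ρ, rfl⟩
    rw [SetLike.mem_coe, LinearMap.mem_ker, Matrix.mulVecLin_apply]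
    funext d
    simp only [Matrix.mulVec, dotProduct, Rm, Matrix.of_apply, Pi.zero_apply]
    have hρ : ρ.1 ∈ F.dem.filter (fun d => F.IsRainbow d) := hR ρ.2
    have horth := F.rbVec_orth (mem_filter.1 hρ).1 (mem_filter.1 hρ).2 (mem_filter.1 (mem_filter.1 d.2).1).1
      (mem_filter.1 (mem_filter.1 d.2).1).2
    have hdv : F.lab d.1.1 = v := (mem_filter.1 d.2).2
    have hrestr : (∑ σ ∈ F.sup, F.specRow d.1 σ * F.rbVec ρ.1 σ) = ∑ σ ∈ supV, F.specRow d.1 σ * F.rbVec ρ.1 σ := by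
      rw [hsupV, Finset.sum_filter]
      refine sum_congr rfl fun σ _ => ?_
      by_cases h : F.lab σ.2 = v
      · rw [if_pos h]
      · rw [if_neg h]
        have hne : σ.2 ≠ d.1.1 := fun h' => h (by rw [h']; exact hdv)
        unfold specRow
        rw [if_neg hne, zero_mul]
    rw [hrestr, ← Finset.sum_coe_sort supV] at horth
    exact horth
  -- (4) count dimensions
  have hT : Module.finrank (ZMod 2)
      (Submodule.span (ZMod 2) (Set.range (fun ρ : ↥R => fun σ : ↥supV => F.rbVec ρ.1 σ.1))) = Fintype.card ↥R :=
    finrank_span_eq_card hli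
  have hrn := LinearMap.finrank_range_add_finrank_ker (Matrix.mulVecLin Rm)
  rw [Module.finrank_fintype_fun_eq_card, hrank] at hrn
  have hle := Submodule.finrank_mono hker
  rw [hT] at hle
  have hcards : Fintype.card ↥SPV + Fintype.card ↥R ≤ Fintype.card ↥supV := by omega
  rw [Fintype.card_coe, Fintype.card_coe, Fintype.card_coe] at hcards
  rw [hSPV, F.card_dem_spec_eq v hv, hsupV, F.card_sup_spec_eq v hv] at hcards
  unfold cubeSlack
  rw [Finset.sum_sub_distrib]
  have : ((∑ S ∈ (Finset.univ : Finset (Finset α)).filter (fun S => F.lab S = v), F.crCard Sᶜ) + R.card : ℤ)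
      ≤ ((∑ S ∈ (Finset.univ : Finset (Finset α)).filter (fun S => F.lab S = v), F.abCard Sᶜ : ℕ) : ℤ) := by exact_mod_cast hcards
  push_cast at this
  linarith

end Sunflower

/-! ## The typed conjecture and the reduction -/

/-- **RAINBOW MATROID PARTITION** (MP; this work; OPEN, census-clean — see the file header): for every sunflower the rainbows split into two
classes `R_B ⊔ R_A` such that the two-stage rainbow vectors of `R_B`, restricted to the BOTTOM-spectator supplies (their `TS-B` parts), are
linearly independent over `GF(2)`, and those of `R_A`, restricted to the KERNEL-spectator supplies (their `TS-A` parts), are linearly independent.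
Implied by `RainbowKernelIndependence` (matroid union); implies ★.  An obligation, never a fact: use as `(h : RainbowMatroidPartition)`.
[status: open] -/
@[conjecture] def RainbowMatroidPartition : Prop :=
  ∀ (α : Type) [Fintype α] [DecidableEq α] (F : Sunflower α),
    ∃ RB RA : Finset (Finset α × Finset α),
      RB ⊆ F.dem.filter (fun d => F.IsRainbow d) ∧ RA ⊆ F.dem.filter (fun d => F.IsRainbow d) ∧ Disjoint RB RA ∧
      RB ∪ RA = F.dem.filter (fun d => F.IsRainbow d) ∧
      LinearIndependent (ZMod 2)
        (fun ρ : ↥RB => fun σ : ↥(F.sup.filter (fun σ => F.lab σ.2 = 0)) => F.rbVec ρ.1 σ.1) ∧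
      LinearIndependent (ZMod 2)
        (fun ρ : ↥RA => fun σ : ↥(F.sup.filter (fun σ => F.lab σ.2 = 4)) => F.rbVec ρ.1 σ.1)

/-- **MP ⟹ ★** (this work): `#rainbows = #R_B + #R_A ≤ Σ_{lab S = 0} cubeSlack Sᶜ + Σ_{lab S = 4} cubeSlack Sᶜ`, and
`ZH = 6·(Σ_B + Σ_A − #rainbows)` (`ZH_eq_six_slack`). [this work] -/
theorem partitionLemmaH_of_rainbowMatroidPartition (h : RainbowMatroidPartition) : PartitionLemmaH := by
  intro α _ _ F
  obtain ⟨RB, RA, hRB, hRA, hdisj, hunion, hliB, hliA⟩ := h α F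
  have hB := F.card_le_slack_of_linearIndependent 0 (Or.inr rfl) RB hRB hliB
  have hA := F.card_le_slack_of_linearIndependent 4 (Or.inl rfl) RA hRA hliA
  have hcard : F.rainbowCard = RB.card + RA.card := by
    unfold Sunflower.rainbowCard
    rw [← hunion, Finset.card_union_of_disjoint hdisj]
  rw [F.ZH_eq_six_slack, hcard]
  push_cast
  linarith

end Summit.CriticalPhenomena.PercolationContinuityZ3.Theorems.SunflowerPartition
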